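import Summits.CriticalPhenomena.Ising3DConformalLimit.Theses.LatticeSDPCertificates
import Summits.CriticalPhenomena.Ising3DConformalLimit.Theorems.LatticeSDPCertificatesWindowForcesU4MeetSecondMomentBox
import Summits.CriticalPhenomena.Ising3DConformalLimit.Theorems.LatticeSDPCertificatesWindowForcesU4WindowLatticeMomentRatio
import HarnessLib

/-!
# Crux `WindowForcesU4` (stmt-CriticalPhenomena-5505, route `LatticeSDPCertificates`), line `birth`/`registered`:
# WINDOW forces NON-DEGENERATE DUPLICATED MEETING at every scale (stub A = A1 ∘ A2, sorry-free)

`windowDuplicatedMeeting`: if the axial critical two-point function of the n.n. Ising model on `ℤ³` satisfies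
WINDOW (`WindowBelowHalf`: `c (n/m)^{-(3/2-ε)} G(m e₁) ≤ G(n e₁)` for `1 ≤ m ≤ n`), then for every injective
lattice shape `y : Fin 4 → ℤ³` there is `c(y) > 0` such that for all large dilations `L`, eventually in the
box size `n`, the two INDEPENDENT duplicated critical clusters `C_{n₁+n₂}(Ly₀)` (sources `Ly₀, Ly₁`) and
`C_{n₃+n₄}(Ly₂)` (sources `Ly₂, Ly₃`) of the free box `Λ_n ⊂ ℤ³` at `β_c(3)` share a vertex with probability
`meet n (L•y) ≥ c(y)` (the object of Aizenman–Duminil-Copin 2021 (3.13)).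

It is the glue of the two landed registered stubs of the checked skeleton
`Cruxes/WindowForcesU4/Lines/birth.lean`: A1 `stub_meetSecondMomentBox` (second-moment inequality
`M₁²/M₂ ≤ meet` in the free box, file `…WindowForcesU4MeetSecondMomentBox`) and A2
`stub_windowLatticeMomentRatio` (WINDOW ⇒ `M₁²/M₂ ≥ c(y)` at a counting region `Λ_L + 3DL·e₁`, file
`…WindowForcesU4WindowLatticeMomentRatio`), i.e. ADC21 Lemma 4.4 run ON THE LATTICE with WINDOW's top-heavy
bubble in place of the `d = 4` bubble divergence. This was the statement registered at birth as
`stub_windowDuplicatedMeeting`; it is the "fat" half of the line — the open half is the `meet → merge`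
comparison (`stub_windowLatticeMeetingRobustness`).

References: M. Aizenman, H. Duminil-Copin, Ann. of Math. 194 (2021) = arXiv:1912.07973, §3 (3.13), §4.2
Lemma 4.4, App. A Prop. A.3.
-/

noncomputable section

namespace Summit.CriticalPhenomena.Ising3DConformalLimit.LatticeSDPCertificatesWindowForcesU4

open Filter Topology
open Literature.Probability.LatticeModels Literature.Probability.Percolation
open Summit.CriticalPhenomena.Ising3DConformalLimit.Theses.LatticeSDPCertificates (WindowBelowHalf)
open Summit.CriticalPhenomena.Ising3DConformalLimit.GapForcesFarMergingSandwich (meet)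
open Summit.CriticalPhenomena.Ising3DConformalLimit.Cruxes.IsingEuclidUpgradeR4NonGaussian.FreeCovarianceDeltaDichotomy
  (boxMoment₁ boxMoment₂)
open MeetSecondMomentBoxProof (stub_meetSecondMomentBox)
open WindowLatticeMomentRatioProof (stub_windowLatticeMomentRatio)

/-- Eventually in the box size `n`, the four dilated sources `L•yᵢ` lie in `Λ_n`. [folklore] -/
theorem eventually_smul_mem_box (L : ℕ) (y : Fin 4 → Site 3) :
    ∀ᶠ n : ℕ in atTop, ∀ i, (L : ℤ) • y i ∈ box 3 n := by
  classical
  obtain ⟨n₀, hn₀⟩ := exists_forall_subset_box 3 (Finset.univ.image fun i => (L : ℤ) • y i)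
  filter_upwards [eventually_ge_atTop n₀] with n hn
  exact fun i => hn₀ n hn (Finset.mem_image_of_mem _ (Finset.mem_univ i))

/-- **Glue of ADC21 Lemma 4.4 on the lattice (statement form).** The second-moment inequality (A1) at the
counting region of the moment-ratio bound (A2) gives non-degenerate duplicated meeting at every injective
shape. [cite: AizenmanDuminilCopinAnnals2021, §4.2 Lemma 4.4 and App. A Prop. A.3] -/
theorem windowDuplicatedMeeting_of
    (h1 : ∀ (n : ℕ) (y : Fin 4 → Site 3), (∀ i, y i ∈ box 3 n) →
      ∀ A : Finset (Site 3), A ⊆ box 3 n →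
        boxMoment₁ n (y 0) (y 1) (y 2) (y 3) A ^ 2 / boxMoment₂ n (y 0) (y 1) (y 2) (y 3) A ≤
          meet n y)
    (h2 : WindowBelowHalf → ∀ y : Fin 4 → Site 3, Function.Injective y →
      ∃ c : ℝ, 0 < c ∧ ∀ᶠ L : ℕ in atTop, ∃ A : Finset (Site 3), ∀ᶠ n : ℕ in atTop,
        A ⊆ box 3 n ∧
          c ≤ boxMoment₁ n ((L : ℤ) • y 0) ((L : ℤ) • y 1) ((L : ℤ) • y 2) ((L : ℤ) • y 3) A ^ 2 /
                boxMoment₂ n ((L : ℤ) • y 0) ((L : ℤ) • y 1) ((L : ℤ) • y 2) ((L : ℤ) • y 3) A) :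
    WindowBelowHalf → ∀ y : Fin 4 → Site 3, Function.Injective y →
      ∃ c : ℝ, 0 < c ∧ ∀ᶠ L : ℕ in atTop, ∀ᶠ n : ℕ in atTop,
        c ≤ meet n (fun i => (L : ℤ) • y i) := by
  intro hW y hy
  obtain ⟨c, hc, hL⟩ := h2 hW y hy
  refine ⟨c, hc, ?_⟩
  filter_upwards [hL] with L ⟨A, hA⟩
  filter_upwards [hA, eventually_smul_mem_box L y] with n ⟨hAn, hcn⟩ hyn
  exact hcn.trans (h1 n (fun i => (L : ℤ) • y i) hyn A hAn)

/-- **WINDOW ⇒ NON-DEGENERATE DUPLICATED MEETING.** Under WINDOW (`WindowBelowHalf`), for every injective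
lattice shape `y` there is `c = c(y) > 0` such that for all large dilations `L`, eventually in the box size
`n`, the two independent duplicated critical clusters `C_{n₁+n₂}(Ly₀)`, `C_{n₃+n₄}(Ly₂)` of the free box
`Λ_n ⊂ ℤ³` at `β_c(3)` share a vertex with probability `≥ c`:
`c ≤ meet n (L•y) = P^{Ly₀Ly₁,∅} ⊗ P^{Ly₂Ly₃,∅}_{Λ_n}[C_{n₁+n₂}(Ly₀) ∩ C_{n₃+n₄}(Ly₂) ≠ ∅]`.
(ADC21 Lemma 4.4 on the lattice: A1 `stub_meetSecondMomentBox` ∘ A2 `stub_windowLatticeMomentRatio`.)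
[cite: AizenmanDuminilCopinAnnals2021, §4.2 Lemma 4.4 and App. A Prop. A.3] -/
theorem windowDuplicatedMeeting :
    WindowBelowHalf → ∀ y : Fin 4 → Site 3, Function.Injective y →
      ∃ c : ℝ, 0 < c ∧ ∀ᶠ L : ℕ in atTop, ∀ᶠ n : ℕ in atTop,
        c ≤ meet n (fun i => (L : ℤ) • y i) :=
  windowDuplicatedMeeting_of stub_meetSecondMomentBox stub_windowLatticeMomentRatio

end Summit.CriticalPhenomena.Ising3DConformalLimit.LatticeSDPCertificatesWindowForcesU4

end
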